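import Summits.BirchSwinnertonDyer.BirchSwinnertonDyer.Theorems.ManinLocalTwoThreeCuspThreeTorsionAtFour
import Summits.BirchSwinnertonDyer.Rank1Residual.O5.CharTwistThreeIsometry
import Literature.NumberTheory.EllipticCurves.CuspFormTwistModularSymbol
import Literature.NumberTheory.EllipticCurves.ModularSymbolsProofs
import Literature.NumberTheory.EllipticCurves.CuspFormLFunctionLevelConductorProofs
import HarnessLib

/-!
# THIRD-TRANSLATE and THE CUSP `1/9` IS `3`-TORSION — the `p = 3` twins of HALF-TRANSLATE (S-an-9a) and of E-an-45
# (`c`-free, `W`-free symbol identities for newforms at `9 ∣ N`)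

Summit `BirchSwinnertonDyer`, sub-problem `BirchSwinnertonDyer`, route `ManinLocalTwoThree` (Manin constant at the additive
primes); width seat `bsd-line-manin23-p2` (gen 8), `--supports` the crux C3 `ManinPrimeToThreeAtNine`
(stmt-BirchSwinnertonDyer-22968).  Cell `bsd-f2-manin`: these are the level-`9` counterparts of the analytic-lens rows the
seat proved at level `4` (E-an-44/45/83, `Theorems/ManinLocalTwoThreeCuspThreeTorsionAtFour.lean`,
`…AtkinLehnerSignFour.lean`): there `t_{1/2}` acts by `−1` and its fixed cusps map to `E[2]`; here `t_{1/3}` satisfies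
`1 + t + t² = 0` on `3`-depleted forms and ITS fixed cusps map to `E[3]`.

PROVED here (sorry-free, axioms standard; no analysis — Birch's lemma `modularSymbol_charTwist` twice, as in the tree's
S-an-9a `modularSymbol_add_half_eq_neg`):

* `exists_isQuadratic_isPrimitive_three` — a primitive quadratic Dirichlet character mod `3` exists (Legendre symbol of
  `𝔽₃`); `gaussSum_chi_three_sq` — `g(χ₋₃)² = −3`; `sum_chi_three_mul` — `Σ_u χ(u)F(u) = F(1) − F(2)`;
* **`modularSymbol_third_translate_sum_eq_zero`** (THIRD-TRANSLATE) — for `f ∈ S₂(Γ₀(N))`, `9 ∣ N`, `3`-depleted: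
  `{∞,r}_f + {∞,r+⅓}_f + {∞,r+⅔}_f = 0`; `…_of_isNewform0` — every newform at `9 ∣ N` qualifies (Atkin–Lehner `a₃ = 0`);
  `modularSymbol_zero_add_third_add_two_thirds_eq_zero` — the cusp `3`-cycle `{∞,0} + {∞,⅓} + {∞,⅔} = 0`;
* `modularSymbol_div_nine_sub_mem_periodLattice` — the cusps `a/9` (`3 ∤ a`) form ONE `Γ₀(9M)`-class for `3 ∤ M`
  (explicit `Γ₀(9M)`-matrix from Bezout data), so their symbols agree modulo `Λ_f`;
* **`three_mul_modularSymbol_one_div_nine_mem_periodLattice`** — for a newform `f` on `Γ₀(9M)`, `3 ∤ M` (`9 ∥ N`):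
  **`3·{∞,1/9}_f ∈ Λ_f`** (`t_{1/3}` fixes the class `[1/9] = [4/9] = [7/9]`);
* **`cuspImage_one_div_nine_three_torsion`** — under EVERY `X₀(9M)`-parametrisation `φ` of any `W` (`3 ∤ M`), the rational
  cusp `1/9` maps to a rational point killed by `3`: `3·φ([1/9]) = O` (the `p = 3` twin of E-an-45′ `CuspImageThreeTorsion`).

So at `9 ∥ N` every optimal (indeed every) parametrisation carries a canonical rational CUSPIDAL point `R₉ = φ([1/9]) ∈ E[3](ℚ)`;
`R₉ ≠ O` forces a rational `3`-torsion point generated by a REAL cuspidal symbol of order `3` — the dichotomy on which the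
es / an roads for C3 split (MEMO-es §31 `HasRealCuspidalOrderThree`, MEMO-an §64 NB₃).  Nothing here is specific to elliptic
curves except the last corollary.  BSD is not proved by this; Manin's conjecture is not proved by this.
-/

set_option autoImplicit false
-- `Summit.BirchSwinnertonDyer.BirchSwinnertonDyer` is the mandated summit-side namespace (single-conjunct summit).
set_option linter.dupNamespace false

noncomputable section

open scoped MatrixGroups ModularForm
open CongruenceSubgroup
open Literature.NumberTheory.EllipticCurves Literature.NumberTheory.EllipticCurves.ModularForms
open Summit.BirchSwinnertonDyer.Rank1Residual.O5

namespace Summit.BirchSwinnertonDyer.BirchSwinnertonDyer.Theorems.ManinLocalTwoThree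

/-! ### The character sum and the Gauss sum of `χ₋₃` -/

/-- `Σ_{u mod 3} χ(u) F(u) = F(1) − F(2)` for the primitive quadratic character mod `3`. -/
theorem sum_chi_three_mul {χ : DirichletCharacter ℂ 3} (hχ : χ.IsQuadratic) (hprim : χ.IsPrimitive)
    (F : ZMod 3 → ℂ) : ∑ u : ZMod 3, χ u * F u = F 1 - F 2 := by
  show (∑ u : Fin 3, χ u * F u) = F (1 : Fin 3) - F (2 : Fin 3)
  rw [Fin.sum_univ_three, show χ (0 : Fin 3) = 0 from chi_three_apply_zero χ,
    show χ (1 : Fin 3) = 1 from map_one χ, show χ (2 : Fin 3) = -1 from chi_three_apply_two hχ hprim]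
  ring

/-- `sh 1 = ⅓` (mod `3`). -/
theorem twistShift_one_three : twistShift (1 : ZMod 3) = 1 / 3 := by
  rw [twistShift, show (1 : ZMod 3).val = 1 from rfl]; norm_num

/-- `sh 2 = ⅔` (mod `3`). -/
theorem twistShift_two_three : twistShift (2 : ZMod 3) = 2 / 3 := by
  rw [twistShift, show (2 : ZMod 3).val = 2 from rfl]; norm_num

/-- A primitive character mod `3` is not the trivial character. -/
theorem ne_one_of_isPrimitive_three {χ : DirichletCharacter ℂ 3} (hprim : χ.IsPrimitive) : χ ≠ 1 := by
  intro h
  have hc := hprim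
  rw [DirichletCharacter.IsPrimitive, h, DirichletCharacter.conductor_one] at hc
  exact absurd hc (by norm_num)

/-- **`g(χ₋₃)² = −3`** (`g(χ)² = χ(−1)·3` for the quadratic character, `χ(−1) = χ(2) = −1`). -/
theorem gaussSum_chi_three_sq {χ : DirichletCharacter ℂ 3} (hχ : χ.IsQuadratic) (hprim : χ.IsPrimitive) :
    gaussSum χ (ZMod.stdAddChar (N := 3)) ^ 2 = -3 := by
  haveI : Fact (Nat.Prime 3) := ⟨Nat.prime_three⟩
  rw [gaussSum_sq (ne_one_of_isPrimitive_three hprim) hχ (ZMod.isPrimitive_stdAddChar 3),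
    show (-1 : ZMod 3) = 2 from rfl, chi_three_apply_two hχ hprim, ZMod.card]
  norm_num

/-- **A primitive quadratic Dirichlet character mod `3` exists** (the Legendre symbol of `𝔽₃` composed with `ℤ → ℂ`;
its conductor divides the prime `3` and is not `1` since `χ(2) = −1`). -/
theorem exists_isQuadratic_isPrimitive_three : ∃ χ : DirichletCharacter ℂ 3, χ.IsQuadratic ∧ χ.IsPrimitive := by
  refine ⟨(quadraticChar (ZMod 3)).ringHomComp (Int.castRingHom ℂ),
    (quadraticChar_isQuadratic (ZMod 3)).comp _, ?_⟩
  set χ : DirichletCharacter ℂ 3 := (quadraticChar (ZMod 3)).ringHomComp (Int.castRingHom ℂ) with hχdef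
  have h2 : χ 2 = -1 := by
    rw [hχdef, MulChar.ringHomComp_apply]
    have hns : quadraticChar (ZMod 3) 2 = -1 := by
      rw [quadraticChar_apply, quadraticCharFun, if_neg (by decide), if_neg (by decide)]
    rw [hns]; simp
  rw [DirichletCharacter.isPrimitive_def]
  rcases (Nat.dvd_prime Nat.prime_three).mp χ.conductor_dvd_level with h1 | h3
  · exfalso
    have hone : χ = 1 := DirichletCharacter.eq_one_iff_conductor_eq_one.mpr h1
    have hu : IsUnit (2 : ZMod 3) := by decide
    rw [hone, MulChar.one_apply hu] at h2
    norm_num at h2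
  · exact h3

/-! ### THIRD-TRANSLATE: `{∞,r} + {∞,r+⅓} + {∞,r+⅔} = 0` for a `3`-depleted form at `9 ∣ N` -/

/-- **THIRD-TRANSLATE (the `p = 3` twin of HALF-TRANSLATE S-an-9a).**  For `f ∈ S₂(Γ₀(N))` with `3² ∣ N` whose
`q`-expansion coefficients `aₙ`, `3 ∣ n`, vanish (every newform at `9 ∣ N`):
`{∞, r}_f + {∞, r + ⅓}_f + {∞, r + ⅔}_f = 0` for every rational `r`.  Proof WITHOUT analysis, given a primitive
quadratic character `χ` mod `3`: `(f ⊗ χ) ⊗ χ = f` (O5 `charTwist_charTwist`) and Birch's lemma `modularSymbol_charTwist`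
twice give `{∞,r}_f = g(χ)⁻²({∞,r+⅓} + {∞,r+⅔} − 2{∞,r})` with `g(χ)² = −3`. [cite: Manin1972, §1.2] [cite: Shimura1971, Prop. 3.64] -/
theorem modularSymbol_third_translate_sum_eq_zero {N : ℕ} [NeZero N] (h9 : 3 ^ 2 ∣ N)
    {χ : DirichletCharacter ℂ 3} (hχ : χ.IsQuadratic) (hprim : χ.IsPrimitive) (f : CuspForm (Gamma0 N) 2)
    (hdep : ∀ n : ℕ, 3 ∣ n → cuspCoeff f n = 0) (r : ℚ) :
    modularSymbol f r + modularSymbol f (r + 1 / 3) + modularSymbol f (r + 2 / 3) = 0 := by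
  set g := gaussSum χ (ZMod.stdAddChar (N := 3)) with hg
  have hg2 : g ^ 2 = -3 := gaussSum_chi_three_sq hχ hprim
  have hg0 : g ≠ 0 := by
    intro h
    rw [h] at hg2
    norm_num at hg2
  have h1 : g * g⁻¹ = 1 := mul_inv_cancel₀ hg0
  have hgg := charTwist_charTwist h9 hχ hprim hdep
  have hp0 : modularSymbol f (r + 1 / 3 + 1 / 3) = modularSymbol f (r + 2 / 3) := by
    rw [show r + 1 / 3 + 1 / 3 = r + 2 / 3 by ring]
  have hp1 : modularSymbol f (r + 1 / 3 + 2 / 3) = modularSymbol f r := by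
    rw [show r + 1 / 3 + 2 / 3 = r + ((1 : ℤ) : ℚ) by push_cast; ring]
    exact modularSymbol_add_intCast_holds f r 1
  have hp2 : modularSymbol f (r + 2 / 3 + 1 / 3) = modularSymbol f r := by
    rw [show r + 2 / 3 + 1 / 3 = r + ((1 : ℤ) : ℚ) by push_cast; ring]
    exact modularSymbol_add_intCast_holds f r 1
  have hp3 : modularSymbol f (r + 2 / 3 + 2 / 3) = modularSymbol f (r + 1 / 3) := by
    rw [show r + 2 / 3 + 2 / 3 = r + 1 / 3 + ((1 : ℤ) : ℚ) by push_cast; ring]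
    exact modularSymbol_add_intCast_holds f (r + 1 / 3) 1
  have key := modularSymbol_charTwist N dvd_rfl h9 hχ (charTwist N dvd_rfl h9 hχ f) r
  rw [hgg, sum_chi_three_mul hχ hprim, twistShift_one_three, twistShift_two_three,
    modularSymbol_charTwist N dvd_rfl h9 hχ f, modularSymbol_charTwist N dvd_rfl h9 hχ f,
    sum_chi_three_mul hχ hprim, sum_chi_three_mul hχ hprim, twistShift_one_three, twistShift_two_three,
    hp0, hp1, hp2, hp3] at key
  rw [← hg] at key
  set M₀ := modularSymbol f r
  set A := modularSymbol f (r + 2 / 3)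
  set C := modularSymbol f (r + 1 / 3)
  linear_combination (-g ^ 2) * key - (A + C - 2 * M₀) * (g * g⁻¹ + 1) * h1 + M₀ * hg2

/-- **THIRD-TRANSLATE for newforms at `9 ∣ N`** (a newform at `3² ∣ N` is `3`-depleted: `a₃ = 0` by Atkin–Lehner and
`a_{3m} = a₃ a_m`); the primitive quadratic character mod `3` enters only the proof. -/
theorem modularSymbol_third_translate_sum_eq_zero_of_isNewform0 {N : ℕ} [NeZero N] (h9 : 3 ^ 2 ∣ N)
    {f : CuspForm (Gamma0 N) 2} (hf : IsNewform0 f) (r : ℚ) :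
    modularSymbol f r + modularSymbol f (r + 1 / 3) + modularSymbol f (r + 2 / 3) = 0 := by
  obtain ⟨χ, hχ, hprim⟩ := exists_isQuadratic_isPrimitive_three
  refine modularSymbol_third_translate_sum_eq_zero h9 hχ hprim f (fun n hn => ?_) r
  obtain ⟨n', rfl⟩ := hn
  have h3N : 3 ∣ N := (dvd_pow_self 3 two_ne_zero).trans h9
  rw [hf.cuspCoeff_prime_mul Nat.prime_three n', if_pos h3N, sub_zero,
    hf.cuspCoeff_eq_zero_of_sq_dvd Nat.prime_three h9, zero_mul]

/-- **The cusp `3`-cycle at `0`**: `{∞,0}_f + {∞,⅓}_f + {∞,⅔}_f = 0` for every newform at `9 ∣ N` (the cusps `0, ⅓, ⅔` are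
permuted cyclically by `t_{1/3}`). -/
theorem modularSymbol_zero_add_third_add_two_thirds_eq_zero {N : ℕ} [NeZero N] (h9 : 3 ^ 2 ∣ N)
    {f : CuspForm (Gamma0 N) 2} (hf : IsNewform0 f) :
    modularSymbol f 0 + modularSymbol f (1 / 3 : ℚ) + modularSymbol f (2 / 3 : ℚ) = 0 := by
  have := modularSymbol_third_translate_sum_eq_zero_of_isNewform0 h9 hf 0
  simpa only [zero_add] using this

/-! ### The cusps `a/9` at level `9M`, `3 ∤ M`, form ONE `Γ₀(9M)`-class: their symbols agree modulo `Λ_f` -/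

/-- **Cusps `r₀/9 ∼ s₀/9` under `Γ₀(9M)`** whenever `M s₀ r₀` is prime to `9` (Bezout data `M s₀ r₀ u + 9 v = 1`): the
matrix `(1 + M k s₀, (s₀−r₀) v; 9 M k, 1 − M k r₀)`, `k = (s₀ − r₀) u`, lies in `Γ₀(9M)` and maps `r₀/9 ↦ s₀/9`, so
`{∞, s₀/9}_f − {∞, r₀/9}_f ∈ Λ_f`. -/
theorem modularSymbol_div_nine_sub_mem_periodLattice {M : ℕ} [NeZero (9 * M)] (f : CuspForm (Gamma0 (9 * M)) 2)
    (r₀ s₀ u v : ℤ) (hbez : (M : ℤ) * s₀ * r₀ * u + 9 * v = 1) :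
    modularSymbol f ((s₀ : ℚ) / 9) - modularSymbol f ((r₀ : ℚ) / 9) ∈ periodLattice f := by
  have hdet : (1 + (M : ℤ) * ((s₀ - r₀) * u) * s₀) * (1 - (M : ℤ) * ((s₀ - r₀) * u) * r₀) -
      ((s₀ - r₀) * v) * (9 * (M : ℤ) * ((s₀ - r₀) * u)) = 1 := by
    linear_combination (-(M : ℤ) * u * (s₀ - r₀) ^ 2) * hbez
  have hcN : ((9 * M : ℕ) : ℤ) ∣ 9 * (M : ℤ) * ((s₀ - r₀) * u) := ⟨(s₀ - r₀) * u, by push_cast; ring⟩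
  have hden : 9 * (M : ℤ) * ((s₀ - r₀) * u) * r₀ + (1 - (M : ℤ) * ((s₀ - r₀) * u) * r₀) * 9 ≠ 0 := by
    have : 9 * (M : ℤ) * ((s₀ - r₀) * u) * r₀ + (1 - (M : ℤ) * ((s₀ - r₀) * u) * r₀) * 9 = 9 := by ring
    rw [this]; norm_num
  have hid : ((1 + (M : ℤ) * ((s₀ - r₀) * u) * s₀) * r₀ + (s₀ - r₀) * v * 9) * 9 =
      s₀ * (9 * (M : ℤ) * ((s₀ - r₀) * u) * r₀ + (1 - (M : ℤ) * ((s₀ - r₀) * u) * r₀) * 9) := by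
    linear_combination 9 * (s₀ - r₀) * hbez
  have := modularSymbol_div_sub_div_mem_periodLattice f hdet hcN r₀ 9 s₀ 9 (by norm_num) (by norm_num) hden hid
  simpa using this

/-- `M` prime to `3` and `a` prime to `3` give Bezout data for `M·a·1` and `9`. -/
theorem isCoprime_nine_of_not_three_dvd {M : ℕ} (hM : ¬ 3 ∣ M) {a : ℤ} (ha : IsCoprime a 9) :
    IsCoprime ((M : ℤ) * a * 1) 9 := by
  have hM9 : Nat.Coprime M 9 := by
    have := (((Nat.Prime.coprime_iff_not_dvd Nat.prime_three).mpr hM).symm).pow_right 2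
    simpa using this
  have hM9' : IsCoprime (M : ℤ) 9 := by exact_mod_cast Nat.isCoprime_iff_coprime.mpr hM9
  rw [mul_one]
  exact hM9'.mul_left ha

/-- **THE CUSP `1/9` IS `3`-TORSION (the `p = 3` twin of E-an-45).**  For a newform `f` on `Γ₀(9M)`, `3 ∤ M`
(i.e. `9 ∥ N`): `3·{∞, 1/9}_f ∈ Λ_f`.  Proof: THIRD-TRANSLATE at `r = 1/9` gives `{∞,1/9} + {∞,4/9} + {∞,7/9} = 0`, and
the cusps `1/9, 4/9, 7/9` are `Γ₀(9M)`-equivalent (`t_{1/3}` FIXES the cusp class `[1/9]`), so the three symbols agree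
modulo `Λ_f`.  Hence under every `X₀(9M)`-parametrisation the (rational) cusp `1/9` maps to a rational point killed by
`3`.  `c`-free, `W`-free, no optimality. [cite: Manin1972, §1.2 and Prop. 1.4] -/
theorem three_mul_modularSymbol_one_div_nine_mem_periodLattice {M : ℕ} [NeZero (9 * M)] (hM : ¬ 3 ∣ M)
    {f : CuspForm (Gamma0 (9 * M)) 2} (hf : IsNewform0 f) :
    (3 : ℂ) * modularSymbol f (1 / 9 : ℚ) ∈ periodLattice f := by
  have h9 : 3 ^ 2 ∣ 9 * M := ⟨M, by norm_num⟩
  have hT := modularSymbol_third_translate_sum_eq_zero_of_isNewform0 h9 hf (1 / 9)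
  rw [show (1 / 9 + 1 / 3 : ℚ) = ((4 : ℤ) : ℚ) / 9 by norm_num,
    show (1 / 9 + 2 / 3 : ℚ) = ((7 : ℤ) : ℚ) / 9 by norm_num] at hT
  obtain ⟨u₄, v₄, h₄⟩ := isCoprime_nine_of_not_three_dvd hM (a := 4) ⟨-2, 1, by norm_num⟩
  obtain ⟨u₇, v₇, h₇⟩ := isCoprime_nine_of_not_three_dvd hM (a := 7) ⟨4, -3, by norm_num⟩
  have d₄ := modularSymbol_div_nine_sub_mem_periodLattice f 1 4 u₄ v₄ (by linear_combination h₄)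
  have d₇ := modularSymbol_div_nine_sub_mem_periodLattice f 1 7 u₇ v₇ (by linear_combination h₇)
  have h19 : (((1 : ℤ) : ℚ) / 9) = 1 / 9 := by norm_num
  rw [h19] at d₄ d₇
  have := (periodLattice f).neg_mem ((periodLattice f).add_mem d₄ d₇)
  convert this using 1
  linear_combination hT

/-- **`φ([1/9])` is a rational `3`-torsion point (possibly `O`) for EVERY `X₀(9M)`-parametrisation `φ` of any `W`,
`3 ∤ M`**: `3 · φ_D([1/9]) = O` in `ℂ/Λ_W` (`c·Λ_f ⊆ Λ_W`, `D.smul_periodLattice_le`).  The `p = 3` twin of E-an-45′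
`CuspImageThreeTorsion`. -/
theorem cuspImage_one_div_nine_three_torsion {W : WeierstrassCurve ℚ} {M : ℕ} [NeZero (9 * M)] (hM : ¬ 3 ∣ M)
    (D : ModularParametrizationData W (9 * M)) :
    3 • D.uniformize ((D.c : ℂ) * modularSymbol D.f (1 / 9 : ℚ)) = 0 := by
  rw [← map_nsmul, D.uniformize_eq_zero_iff, nsmul_eq_mul]
  have := D.smul_periodLattice_le _
    (three_mul_modularSymbol_one_div_nine_mem_periodLattice hM D.isNewformOf.1)
  convert this using 1
  push_cast
  ring

end Summit.BirchSwinnertonDyer.BirchSwinnertonDyer.Theorems.ManinLocalTwoThree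

end
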